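import Mathlib
import Summits.ResolutionOfSingularities.ResolutionOfSingularities.Theorems.WildQuotientsWildQuotientResolutionJordanFiveMu2CoverDefs
import Summits.ResolutionOfSingularities.ResolutionOfSingularities.Theorems.FrobeniusClosingPatchingRelPerfectQuotientRegularityTools

/-!
# R-T rung, `J₅`, `μ₂`-vertex: the twisted-root cover `U₂ = (k[s,Y,pass] ⧸ (Φ))[1/î]` is a regular ring

(crux stmt-ResolutionOfSingularities-15640 `WildQuotients.WildQuotientResolution`, line `Sketch`,
sector `|G| = p`; RUNG V5 of `L/w45c/CHAIN.md` v8.1, brick B7/`HP₂` step (α) part 2d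
(res-L1-w45c-plan-1 RULING 2026-08-27T11:12Z; the `IsRegularRing` input of Király–Lütkebohmert
`TameTransfer.isRegularRing_fixedPoints_zpowers`, p460154); smoothness certificate = res-L1-w45c-idea-2's
weighted EULER identity (`W2Euler.lean` b79f004da20cc391; in the tree as
`JordanFive.four_mul_coverIHat_eq`, p530316), Jacobian criterion = the tree's
`MvPolynomial.isRegularLocalRing_localization_quotient_of_pderiv_notMem`
(`…FrobeniusClosingPatchingRelPerfectQuotientRegularityTools`, Matsumura 14.2).
[OURS · L1 W4.5c] — NOT a statement of any manuscript; replaces the role of no printed item.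
Prover res-type-036. Def-free.)

`A = MvPolynomial (Option (Fin n)) k` (`s = X none`, `Yᵢ = X (some ·)` on the slots `a,…,e`),
`Φ = coverPhi s Y₀ Y₁ Y₂ Y₃ Y₄`, `î = coverIHat …`, `B = A ⧸ (Φ)`, `U₂ = B[1/î]`.
* `pderiv_coverPhi_none/_a/_b/_c/_d` — the five partial derivatives of `Φ`;
* `four_mul_coverIHat_eq_pderiv` — `4î = 6Φ + s·∂ₛΦ − 4Y₀∂₀Φ − 3Y₁∂₁Φ − 2Y₂∂₂Φ − Y₃∂₃Φ` in `A`;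
* `exists_pderiv_coverPhi_notMem` — at a prime `Q ∋ Φ` with `î ∉ Q` (and `2 ≠ 0` in `k`) some
  `∂Φ/∂v ∉ Q`;
* `isRegularLocalRing_localization_quotient_coverPhi` — `B_{Q̄}` is a regular local ring at every
  prime `Q̄` of `B` not containing `î`;
* **`isRegularRing_away_coverIHat`** — `U₂ = B[1/î]` is a regular ring (its local rings are the
  `B_{Q̄}`, `î ∉ Q̄`).
-/

-- single-problem summit: the doubled namespace component `ResolutionOfSingularities` is forced
set_option linter.dupNamespace false

noncomputable section

open MvPolynomial

namespace Summit.ResolutionOfSingularities.ResolutionOfSingularities.Theorems.WildQuotientResolution.JordanFive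

variable (k : Type) [Field k] (n : ℕ) (a b c d e : Fin n)
  (hab : a ≠ b) (hac : a ≠ c) (had : a ≠ d) (hae : a ≠ e) (hbc : b ≠ c) (hbd : b ≠ d)
  (hbe : b ≠ e) (hcd : c ≠ d) (hce : c ≠ e) (hde : d ≠ e)

/-! ## The five partial derivatives of `Φ` -/

/-- Partial derivatives kill numerals. [folklore] -/
theorem pderiv_natCast' {ι : Type} (i : ι) (m : ℕ) :
    pderiv i ((m : MvPolynomial ι k)) = 0 := Derivation.map_natCast _ m

/-- `∂Φ/∂s`. [OURS · L1 W4.5c; W2Euler `Phi_s`] -/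
theorem pderiv_coverPhi_none :
    pderiv none (coverPhi (X none) (X (some a)) (X (some b)) (X (some c)) (X (some d)) (X (some e)) :
        MvPolynomial (Option (Fin n)) k) =
      -2 * X (some b) * X (some c) + 3 * X (some b) * X (some c) ^ 2
        - 6 * X (some b) ^ 2 * X (some d) + 6 * X (some a) * X (some d)
        + 6 * X (some a) * X (some b) * X (some e) - 2 * X none * X (some b) ^ 2 * X (some c)
        + 4 * X none * X (some a) * X (some c) - 4 * X none * X (some a) * X (some c) ^ 2
        + 12 * X none * X (some a) * X (some b) * X (some d)
        + 3 * X none ^ 2 * X (some a) * X (some b) * X (some c) := by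
  classical
  simp only [coverPhi, coverIHat, coverJHat, map_add, map_sub, map_neg, pderiv_mul, pderiv_pow,
    pderiv_X_self, pderiv_X_of_ne (Option.some_ne_none _)]
  have e2 := pderiv_natCast' k (none : Option (Fin n)) 2
  have e3 := pderiv_natCast' k (none : Option (Fin n)) 3
  have e6 := pderiv_natCast' k (none : Option (Fin n)) 6
  have e9 := pderiv_natCast' k (none : Option (Fin n)) 9
  have e12 := pderiv_natCast' k (none : Option (Fin n)) 12
  simp only [Nat.cast_ofNat] at e2 e3 e6 e9 e12
  simp only [e2, e3, e6, e9, e12, zero_mul, mul_zero, zero_add, add_zero, sub_zero, neg_zero]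
  ring

include hab hac had hae in
/-- `∂Φ/∂Y₀`. [OURS · L1 W4.5c; W2Euler `Phi_0`] -/
theorem pderiv_coverPhi_a :
    pderiv (some a) (coverPhi (X none) (X (some a)) (X (some b)) (X (some c)) (X (some d))
        (X (some e)) : MvPolynomial (Option (Fin n)) k) =
      4 * X (some e) - 9 * X (some d) ^ 2 + 12 * X (some c) * X (some e) + 6 * X none * X (some d)
        + 6 * X none * X (some b) * X (some e) + 2 * X none ^ 2 * X (some c)
        - 2 * X none ^ 2 * X (some c) ^ 2 + 6 * X none ^ 2 * X (some b) * X (some d)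
        + X none ^ 3 * X (some b) * X (some c) := by
  classical
  have hba : (some b : Option (Fin n)) ≠ some a := fun h => hab (Option.some_inj.mp h).symm
  have hca : (some c : Option (Fin n)) ≠ some a := fun h => hac (Option.some_inj.mp h).symm
  have hda : (some d : Option (Fin n)) ≠ some a := fun h => had (Option.some_inj.mp h).symm
  have hea : (some e : Option (Fin n)) ≠ some a := fun h => hae (Option.some_inj.mp h).symm
  have hna : (none : Option (Fin n)) ≠ some a := (Option.some_ne_none a).symm
  simp only [coverPhi, coverIHat, coverJHat, map_add, map_sub, map_neg, pderiv_mul, pderiv_pow,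
    pderiv_X_self, pderiv_X_of_ne hba, pderiv_X_of_ne hca, pderiv_X_of_ne hda, pderiv_X_of_ne hea,
    pderiv_X_of_ne hna]
  have e2 := pderiv_natCast' k (some a : Option (Fin n)) 2
  have e3 := pderiv_natCast' k (some a : Option (Fin n)) 3
  have e6 := pderiv_natCast' k (some a : Option (Fin n)) 6
  have e9 := pderiv_natCast' k (some a : Option (Fin n)) 9
  have e12 := pderiv_natCast' k (some a : Option (Fin n)) 12
  simp only [Nat.cast_ofNat] at e2 e3 e6 e9 e12
  simp only [e2, e3, e6, e9, e12, zero_mul, mul_zero, zero_add, add_zero, sub_zero, neg_zero]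
  ring

include hab hbc hbd hbe in
/-- `∂Φ/∂Y₁`. [OURS · L1 W4.5c; W2Euler `Phi_1`] -/
theorem pderiv_coverPhi_b :
    pderiv (some b) (coverPhi (X none) (X (some a)) (X (some b)) (X (some c)) (X (some d))
        (X (some e)) : MvPolynomial (Option (Fin n)) k) =
      -4 * X (some d) + 6 * X (some c) * X (some d) - 12 * X (some b) * X (some e)
        - 2 * X none * X (some c) + 3 * X none * X (some c) ^ 2 - 12 * X none * X (some b) * X (some d)
        + 6 * X none * X (some a) * X (some e) - 2 * X none ^ 2 * X (some b) * X (some c)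
        + 6 * X none ^ 2 * X (some a) * X (some d) + X none ^ 3 * X (some a) * X (some c) := by
  classical
  have hab' : (some a : Option (Fin n)) ≠ some b := fun h => hab (Option.some_inj.mp h)
  have hcb : (some c : Option (Fin n)) ≠ some b := fun h => hbc (Option.some_inj.mp h).symm
  have hdb : (some d : Option (Fin n)) ≠ some b := fun h => hbd (Option.some_inj.mp h).symm
  have heb : (some e : Option (Fin n)) ≠ some b := fun h => hbe (Option.some_inj.mp h).symm
  have hnb : (none : Option (Fin n)) ≠ some b := (Option.some_ne_none b).symm
  simp only [coverPhi, coverIHat, coverJHat, map_add, map_sub, map_neg, pderiv_mul, pderiv_pow,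
    pderiv_X_self, pderiv_X_of_ne hab', pderiv_X_of_ne hcb, pderiv_X_of_ne hdb, pderiv_X_of_ne heb,
    pderiv_X_of_ne hnb]
  have e2 := pderiv_natCast' k (some b : Option (Fin n)) 2
  have e3 := pderiv_natCast' k (some b : Option (Fin n)) 3
  have e6 := pderiv_natCast' k (some b : Option (Fin n)) 6
  have e9 := pderiv_natCast' k (some b : Option (Fin n)) 9
  have e12 := pderiv_natCast' k (some b : Option (Fin n)) 12
  simp only [Nat.cast_ofNat] at e2 e3 e6 e9 e12
  simp only [e2, e3, e6, e9, e12, zero_mul, mul_zero, zero_add, add_zero, sub_zero, neg_zero]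
  ring

include hac hbc hcd hce in
/-- `∂Φ/∂Y₂`. [OURS · L1 W4.5c; W2Euler `Phi_2`] -/
theorem pderiv_coverPhi_c :
    pderiv (some c) (coverPhi (X none) (X (some a)) (X (some b)) (X (some c)) (X (some d))
        (X (some e)) : MvPolynomial (Option (Fin n)) k) =
      4 * X (some c) - 6 * X (some c) ^ 2 + 6 * X (some b) * X (some d) + 12 * X (some a) * X (some e)
        - 2 * X none * X (some b) + 6 * X none * X (some b) * X (some c) - X none ^ 2 * X (some b) ^ 2
        + 2 * X none ^ 2 * X (some a) - 4 * X none ^ 2 * X (some a) * X (some c)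
        + X none ^ 3 * X (some a) * X (some b) := by
  classical
  have hac' : (some a : Option (Fin n)) ≠ some c := fun h => hac (Option.some_inj.mp h)
  have hbc' : (some b : Option (Fin n)) ≠ some c := fun h => hbc (Option.some_inj.mp h)
  have hdc : (some d : Option (Fin n)) ≠ some c := fun h => hcd (Option.some_inj.mp h).symm
  have hec : (some e : Option (Fin n)) ≠ some c := fun h => hce (Option.some_inj.mp h).symm
  have hnc : (none : Option (Fin n)) ≠ some c := (Option.some_ne_none c).symm
  simp only [coverPhi, coverIHat, coverJHat, map_add, map_sub, map_neg, pderiv_mul, pderiv_pow,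
    pderiv_X_self, pderiv_X_of_ne hac', pderiv_X_of_ne hbc', pderiv_X_of_ne hdc, pderiv_X_of_ne hec,
    pderiv_X_of_ne hnc]
  have e2 := pderiv_natCast' k (some c : Option (Fin n)) 2
  have e3 := pderiv_natCast' k (some c : Option (Fin n)) 3
  have e6 := pderiv_natCast' k (some c : Option (Fin n)) 6
  have e9 := pderiv_natCast' k (some c : Option (Fin n)) 9
  have e12 := pderiv_natCast' k (some c : Option (Fin n)) 12
  simp only [Nat.cast_ofNat] at e2 e3 e6 e9 e12
  simp only [e2, e3, e6, e9, e12, zero_mul, mul_zero, zero_add, add_zero, sub_zero, neg_zero]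
  ring

include had hbd hcd hde in
/-- `∂Φ/∂Y₃`. [OURS · L1 W4.5c; W2Euler `Phi_3`] -/
theorem pderiv_coverPhi_d :
    pderiv (some d) (coverPhi (X none) (X (some a)) (X (some b)) (X (some c)) (X (some d))
        (X (some e)) : MvPolynomial (Option (Fin n)) k) =
      -4 * X (some b) + 6 * X (some b) * X (some c) - 18 * X (some a) * X (some d)
        - 6 * X none * X (some b) ^ 2 + 6 * X none * X (some a)
        + 6 * X none ^ 2 * X (some a) * X (some b) := by
  classical
  have had' : (some a : Option (Fin n)) ≠ some d := fun h => had (Option.some_inj.mp h)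
  have hbd' : (some b : Option (Fin n)) ≠ some d := fun h => hbd (Option.some_inj.mp h)
  have hcd' : (some c : Option (Fin n)) ≠ some d := fun h => hcd (Option.some_inj.mp h)
  have hed : (some e : Option (Fin n)) ≠ some d := fun h => hde (Option.some_inj.mp h).symm
  have hnd : (none : Option (Fin n)) ≠ some d := (Option.some_ne_none d).symm
  simp only [coverPhi, coverIHat, coverJHat, map_add, map_sub, map_neg, pderiv_mul, pderiv_pow,
    pderiv_X_self, pderiv_X_of_ne had', pderiv_X_of_ne hbd', pderiv_X_of_ne hcd', pderiv_X_of_ne hed,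
    pderiv_X_of_ne hnd]
  have e2 := pderiv_natCast' k (some d : Option (Fin n)) 2
  have e3 := pderiv_natCast' k (some d : Option (Fin n)) 3
  have e6 := pderiv_natCast' k (some d : Option (Fin n)) 6
  have e9 := pderiv_natCast' k (some d : Option (Fin n)) 9
  have e12 := pderiv_natCast' k (some d : Option (Fin n)) 12
  simp only [Nat.cast_ofNat] at e2 e3 e6 e9 e12
  simp only [e2, e3, e6, e9, e12, zero_mul, mul_zero, zero_add, add_zero, sub_zero, neg_zero]
  ring

/-! ## The Euler identity with genuine partial derivatives, and the Jacobian criterion -/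

include hab hac had hae hbc hbd hbe hcd hce hde in
/-- **Euler**: `4î = 6Φ + s·∂ₛΦ − 4Y₀·∂₀Φ − 3Y₁·∂₁Φ − 2Y₂·∂₂Φ − Y₃·∂₃Φ` in `k[s, Y, pass]`.
[OURS · L1 W4.5c; res-L1-w45c-idea-2 W2Euler] -/
theorem four_mul_coverIHat_eq_pderiv :
    (4 * coverIHat (X none) (X (some a)) (X (some b)) (X (some c)) (X (some d)) (X (some e)) :
        MvPolynomial (Option (Fin n)) k) =
      6 * coverPhi (X none) (X (some a)) (X (some b)) (X (some c)) (X (some d)) (X (some e))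
      + X none * pderiv none (coverPhi (X none) (X (some a)) (X (some b)) (X (some c))
          (X (some d)) (X (some e)))
      - 4 * X (some a) * pderiv (some a) (coverPhi (X none) (X (some a)) (X (some b)) (X (some c))
          (X (some d)) (X (some e)))
      - 3 * X (some b) * pderiv (some b) (coverPhi (X none) (X (some a)) (X (some b)) (X (some c))
          (X (some d)) (X (some e)))
      - 2 * X (some c) * pderiv (some c) (coverPhi (X none) (X (some a)) (X (some b)) (X (some c))
          (X (some d)) (X (some e)))
      - X (some d) * pderiv (some d) (coverPhi (X none) (X (some a)) (X (some b)) (X (some c))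
          (X (some d)) (X (some e))) := by
  rw [pderiv_coverPhi_none, pderiv_coverPhi_a k n a b c d e hab hac had hae,
    pderiv_coverPhi_b k n a b c d e hab hbc hbd hbe, pderiv_coverPhi_c k n a b c d e hac hbc hcd hce,
    pderiv_coverPhi_d k n a b c d e had hbd hcd hde]
  exact four_mul_coverIHat_eq _ _ _ _ _ _

include hab hac had hae hbc hbd hbe hcd hce hde in
/-- **Jacobian input**: at a prime `Q` of `k[s, Y, pass]` containing `Φ` but not `î` (`2 ≠ 0`),
some partial derivative of `Φ` is not in `Q` (else `4î ∈ Q` by Euler, and `4` is a unit).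
[OURS · L1 W4.5c] -/
theorem exists_pderiv_coverPhi_notMem (h2 : (2 : k) ≠ 0) (Q : Ideal (MvPolynomial (Option (Fin n)) k))
    [Q.IsPrime]
    (hΦ : coverPhi (X none) (X (some a)) (X (some b)) (X (some c)) (X (some d)) (X (some e)) ∈ Q)
    (hI : coverIHat (X none) (X (some a)) (X (some b)) (X (some c)) (X (some d)) (X (some e)) ∉ Q) :
    ∃ o : Option (Fin n),
      pderiv o (coverPhi (X none) (X (some a)) (X (some b)) (X (some c)) (X (some d)) (X (some e)) :
        MvPolynomial (Option (Fin n)) k) ∉ Q := by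
  by_contra hall
  simp only [not_exists, not_not] at hall
  have h4 : (4 : k) ≠ 0 := by
    rw [show (4 : k) = 2 * 2 by norm_num]; exact mul_ne_zero h2 h2
  have hu : IsUnit (4 : MvPolynomial (Option (Fin n)) k) := by
    have hC : IsUnit (C (4 : k) : MvPolynomial (Option (Fin n)) k) :=
      (isUnit_iff_ne_zero.mpr h4).map C
    rwa [map_ofNat] at hC
  have hmem : (4 * coverIHat (X none) (X (some a)) (X (some b)) (X (some c)) (X (some d))
      (X (some e)) : MvPolynomial (Option (Fin n)) k) ∈ Q := by
    rw [four_mul_coverIHat_eq_pderiv k n a b c d e hab hac had hae hbc hbd hbe hcd hce hde]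
    refine sub_mem (sub_mem (sub_mem (sub_mem (add_mem (Ideal.mul_mem_left _ _ hΦ)
      (Ideal.mul_mem_left _ _ (hall none))) (Ideal.mul_mem_left _ _ (hall (some a))))
      (Ideal.mul_mem_left _ _ (hall (some b)))) (Ideal.mul_mem_left _ _ (hall (some c))))
      (Ideal.mul_mem_left _ _ (hall (some d)))
  rcases (Ideal.IsPrime.mem_or_mem ‹Q.IsPrime› hmem) with h | h
  · exact Ideal.IsPrime.ne_top ‹Q.IsPrime› (Ideal.eq_top_of_isUnit_mem _ h hu)
  · exact hI h

include hab hac had hae hbc hbd hbe hcd hce hde in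
/-- **`B_{Q̄}` is a regular local ring** at every prime `Q̄` of `B = k[s,Y,pass] ⧸ (Φ)` not
containing `î` (`2 ≠ 0`; Jacobian criterion). [OURS · L1 W4.5c] -/
theorem isRegularLocalRing_localization_quotient_coverPhi (h2 : (2 : k) ≠ 0)
    (Qbar : Ideal (MvPolynomial (Option (Fin n)) k ⧸ Ideal.span
      {coverPhi (X none) (X (some a)) (X (some b)) (X (some c)) (X (some d))
        (X (some e) : MvPolynomial (Option (Fin n)) k)}))
    [Qbar.IsPrime]
    (hI : Ideal.Quotient.mk _ (coverIHat (X none) (X (some a)) (X (some b)) (X (some c)) (X (some d))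
      (X (some e))) ∉ Qbar) :
    IsRegularLocalRing (Localization.AtPrime Qbar) := by
  have hΦQ : coverPhi (X none) (X (some a)) (X (some b)) (X (some c)) (X (some d)) (X (some e)) ∈
      Qbar.comap (Ideal.Quotient.mk (Ideal.span {coverPhi (X none) (X (some a)) (X (some b))
        (X (some c)) (X (some d)) (X (some e) : MvPolynomial (Option (Fin n)) k)})) := by
    rw [Ideal.mem_comap, Ideal.Quotient.eq_zero_iff_mem.mpr (Ideal.mem_span_singleton_self _)]
    exact Qbar.zero_mem
  have hIQ : coverIHat (X none) (X (some a)) (X (some b)) (X (some c)) (X (some d)) (X (some e)) ∉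
      Qbar.comap (Ideal.Quotient.mk (Ideal.span {coverPhi (X none) (X (some a)) (X (some b))
        (X (some c)) (X (some d)) (X (some e) : MvPolynomial (Option (Fin n)) k)})) :=
    fun h => hI (Ideal.mem_comap.mp h)
  obtain ⟨o, ho⟩ := exists_pderiv_coverPhi_notMem k n a b c d e hab hac had hae hbc hbd hbe hcd hce
    hde h2 _ hΦQ hIQ
  exact MvPolynomial.isRegularLocalRing_localization_quotient_of_pderiv_notMem Qbar o
    (fun h => ho (Ideal.mem_comap.mpr h))

include hab hac had hae hbc hbd hbe hcd hce hde in
/-- **The twisted-root cover `U₂ = (k[s,Y,pass] ⧸ (Φ))[1/î]` is a regular ring** (`2 ≠ 0`): every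
local ring of `U₂` is a local ring `B_{Q̄}` of `B = k[s,Y,pass] ⧸ (Φ)` at a prime not containing
`î`. [OURS · L1 W4.5c] -/
theorem isRegularRing_away_coverIHat (h2 : (2 : k) ≠ 0) :
    IsRegularRing (Localization.Away (Ideal.Quotient.mk (Ideal.span
      {coverPhi (X none) (X (some a)) (X (some b)) (X (some c)) (X (some d))
        (X (some e) : MvPolynomial (Option (Fin n)) k)})
      (coverIHat (X none) (X (some a)) (X (some b)) (X (some c)) (X (some d)) (X (some e))))) := by
  set Φ : MvPolynomial (Option (Fin n)) k :=
    coverPhi (X none) (X (some a)) (X (some b)) (X (some c)) (X (some d)) (X (some e)) with hΦdef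
  set ι : MvPolynomial (Option (Fin n)) k ⧸ Ideal.span {Φ} := Ideal.Quotient.mk (Ideal.span {Φ})
    (coverIHat (X none) (X (some a)) (X (some b)) (X (some c)) (X (some d)) (X (some e))) with hι
  haveI : IsNoetherianRing (Localization.Away ι) :=
    IsLocalization.isNoetherianRing (Submonoid.powers ι) (Localization.Away ι) inferInstance
  rw [isRegularRing_iff]
  intro P hP
  have hIQ : ι ∉ P.comap (algebraMap (MvPolynomial (Option (Fin n)) k ⧸ Ideal.span {Φ})
      (Localization.Away ι)) := by
    intro h
    rw [Ideal.mem_comap] at h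
    exact hP.ne_top (Ideal.eq_top_of_isUnit_mem _ h (IsLocalization.Away.algebraMap_isUnit ι))
  haveI hreg : IsRegularLocalRing (Localization.AtPrime (P.comap (algebraMap
      (MvPolynomial (Option (Fin n)) k ⧸ Ideal.span {Φ}) (Localization.Away ι)))) :=
    isRegularLocalRing_localization_quotient_coverPhi k n a b c d e hab hac had hae hbc hbd hbe hcd
      hce hde h2 _ hIQ
  -- `U_P` is the localisation of `B` at `Q̄ = P ∩ B` (Mathlib `localizationLocalizationAtPrimeIsoLocalization`)
  exact IsRegularLocalRing.of_ringEquiv (R := Localization.AtPrime (P.comap (algebraMap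
      (MvPolynomial (Option (Fin n)) k ⧸ Ideal.span {Φ}) (Localization.Away ι))))
    (IsLocalization.localizationLocalizationAtPrimeIsoLocalization (Submonoid.powers ι) P).toRingEquiv

end Summit.ResolutionOfSingularities.ResolutionOfSingularities.Theorems.WildQuotientResolution.JordanFive

end
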